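import Summits.QuantumFields.YangMills.Theorems.BalabanUVNodesN11Thm2Sect2DataOfRecordKeyedDefs
import Summits.QuantumFields.YangMills.Theorems.BalabanUVNodesN11Thm2Ineq249AtRecord13CoPHOfSect3Analysis

/-!
# DAG node N11 — [III] THEOREM 2 OF RECORD ON THE KEYED CARRIER: PRODUCED from §3's per-point ∕ per-domain sentences (`B14.Thm2Printed` BY NAME at the ₁₃ objects,
# uniformly over a family of runs), CONSUMED toward (2.49) for r11's (2.23)-action (g0 FILE 1), and CONSISTENT (the unit-class inhabitant) — the own-lane A6 repair, step 3 of 3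

Cell `pub-ymgap`, YM-PLAN Track A (HUMAN RULING D-0062 ∕ D-0149), seat `pub-ymgap-dag-n11-w2` (g2), route `BalabanUVNodes`, key item K1⁷ `StabilityBAtRecordR13SepCoPH` =
stmt-QuantumFields-20542 (helper, count-neutral).  [III] = [Balaban1988Convergent], [II] = [Balaban1988RG2Cluster].  Over g2's Defs `…Thm2Sect2DataOfRecordKeyedDefs`
(`sect2DataOfRecord₁₃Keyed θ p 𝒯 𝒰`, `h243_of_ineq243_keyed`, `ineq243_keyed_of_h243`, …), g0 FILE 1 (`ineq249_action23_at_record₁₃CoPH_of_thm2`), FILE 3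
(`h244_at_record₁₃CoPH_of_perDomain`), FILE 4 (`h243_at_record₁₃CoPH_of_perPoint`), FILE 9 (`hcount_at_record₁₃`, `exists_scale_of_mem_Omega`), FILE 10 (`hcountR_at_record₁₃`),
FILE 7 (`EjSub_unit`, `smearedWilson_unit`).  Step 1 = `…Thm2OfRecordUnkeyedCarrierUnsat` (the unkeyed carrier sentence is FALSE); step 2 = the keyed carrier.

WHAT THIS FILE PROVES (0 `sorry`, 0 `def`, standard axioms; count-neutral; nothing of Bałaban's asserted — §3's sentences are HYPOTHESES, displayed per datum).
§1 `ineq243_mono_const` ∕ `ineq244_mono_const` (on any carrier with non-negative volumes ∕ couplings the constants of (2.43) ∕ (2.44) may be enlarged; `L ≥ 0`) ·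
   `h243_mono_vol` ∕ `h244_mono_vol` (the per-scale binders are monotone in the volumes).
§2 PRODUCE.  ★★ `ineq243_keyed_of_sect3E` — at ONE run: if at every datum `(k ≤ K, s, U ∈ 𝒰 k s)` and scale `1 ≤ j ≤ k` the witness `𝒯 k s` admits [III]'s (3.65) partition of
   `φ_j(s)` with support points in `Ω_j(s)` and the per-point sentence (3.67) with ONE constant `cE` and exponent `5 − b`, then `Ineq243 (sect2DataOfRecord₁₃Keyed θ p 𝒯 𝒰) F.L (1−b) cE`
   (the p. 263 count is the THEOREM `hcount_at_record₁₃`) · ★★ `ineq244_keyed_of_sect3R` — if at every datum and scale every (2.30)-admissible domain carries a chosen cube of a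
   scale in `[j, k]` inside `Γ_{sc}(s)` with p. 283's per-domain bound (ONE `cR`, `κ ≥ κ₀(4·2^d, 2d)`), and the couplings are `≥ 0`, `1 ≤ M`, then
   `Ineq244 (sect2DataOfRecord₁₃Keyed θ p 𝒯 𝒰) (cR·K₀(4·2^d, 2d)) κ₀` ([II] (1.26) on the torus and the cube count are THEOREMS) · ★★★ `thm2Printed_keyed_of_sect3Sentences` — for a
   FAMILY of runs `i ↦ (θ i, p i, 𝒯 i, 𝒰 i)` with the E-side data available for every `b > 0` with constants uniform in `i` and the R-side data with uniform `cR, κ`: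
   `B14.Thm2Printed H033 (fun i ↦ sect2DataOfRecord₁₃Keyed (θ i) (p i) (𝒯 i) (𝒰 i)) F.L β κ₀` — THEOREM 2 BY NAME AT THE ₁₃ OBJECTS, the printed uniformity «independent of j, k, Ω,
   {Ω_j}, {Λ_j}, T» being the order of quantifiers.
§3 CONSUME.  `exists_nonneg_constants_of_thm2Printed_keyed` (under `β < 1` and `H033` at the run's flow: `E₁, R₁ ≥ 0` with `Ineq243 ∧ Ineq244` on the keyed carrier) ·
   ★★ `ineq249_action23_of_ineq243_ineq244_keyed` ((2.43) ∧ (2.44) on the keyed carrier + (2.48) + (2.46)'s coupling inputs + the vacuum sentence ⇒ (2.49) for the (2.23)-action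
   of `(s, 𝒯 k s)` at every `U ∈ 𝒰 k s`, any volumes `Γ_n ≥ |Γ_n(s)|` — g0 FILE 1's `…_of_thm2` with `h243 ∕ h244` DISCHARGED from the carrier sentence; replaces g0 FILE 8's vacuous
   `…_of_ineq243OfRecord`) · ★★ `ineq249_action23_of_thm2Printed_keyed` (`B14.Thm2Printed` of record, keyed ⇒ `∃ E₁ R₁ ≥ 0` such that at every datum, under (2.46)'s `R₁`-smallness,
   (2.48) and the vacuum sentence, (2.49) holds with `O(1) = E₁(1−L^{−β})⁻¹ + 1 + 2B₁ + E₂`).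
§4 A6.  `ineq243_keyed_unitClass` ∕ `ineq244_keyed_unitClass` ∕ ★ `thm2Printed_keyed_unitClass`: at the class `𝒰 ≡ {1}` (unit configuration only) the keyed sentences hold with
   `E₁ = R₁ = 0` for EVERY witness family — the keyed Theorem 2 of record is CONSISTENT (contrast: step 1), so §3's consumers are not vacuous by contradiction; the E-side ∕ R-side
   data of §2 are DISPLAYED hypotheses (A2), not exhibited beyond the unit class.

HONEST FRAMING.  Kernel bookkeeping over landed files; [III] §3's analysis ((3.65), (3.67) per point; p. 283 per domain) at the objects of record is HYPOTHESIS, keyed per datum to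
the witness family `𝒯` — it is what the node's 𝐓-step SUPPLY (dag-n11-e's chain: `SupplierObligations`) must deliver about its own constructed terms, nobody's theorem in the tree;
the configuration class `𝒰` is a PARAMETER (print: «U_k = U_k(V), V restricted by the characteristic functions in (2.18)»).  N11 NOT discharged; K1⁷ NOT closed; counts unmoved
(typed 28∕28 · discharged 5∕27).  One finite four-torus programme at fixed `ε = L^{−K}`; R4 closes only the conditional finite-𝕋⁴ rung `BalabanLadder.UV`; NOT ℝ⁴, NOT OS, NOT the
Yang–Mills mass gap (Clay), which none of this proves.
Sources: [III] Thm 2 (2.43)–(2.44) p.263 with preamble L4–6, (2.45)–(2.49) pp.263–264, (3.65)–(3.67) p.283, p.283, (2.1)–(2.2) pp.254–255, (2.23)–(2.25) pp.258–259, (2.30) p.260;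
[II] (1.26) p.8; [Balaban1987RG1] (0.20) p.256.
-/

noncomputable section

open scoped BigOperators Matrix.Norms.L2Operator

namespace Summit.QuantumFields.YangMills.Theorems.BalabanUVNodesN11Thm2OfRecordKeyed

open Literature.MathematicalPhysics.QuantumFieldTheory.Balaban1983to89 Step B14.Eq225Concrete B14.LocalCoupling B14Thm2 B12TreeDecay TreeLengthTorus Finset
open T4Continuum Node00 B15DeterminingSets
open B10Eq38TorusDomains (toFine)
open B14.Eq213MaximalDomains (side)
open BalabanUVNodesN11Thm2Sect2DataOfRecordKeyedDefs
open BalabanUVNodesN11Thm2Ineq249AtRecord13CoPH (ineq249_action23_at_record₁₃CoPH_of_thm2)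
open BalabanUVNodesN11Thm2ESideAtRecord13CoPH (h243_at_record₁₃CoPH_of_perPoint)
open BalabanUVNodesN11Thm2RSideAtRecord13CoPH (h244_at_record₁₃CoPH_of_perDomain)
open BalabanUVNodesN11Thm2PointCountAtRecord13CoPH (hcount_at_record₁₃ exists_scale_of_mem_Omega)
open BalabanUVNodesN11Thm2CubeCountAtRecord13CoPH (hcountR_at_record₁₃)
open BalabanUVNodesN11Thm2Ineq249AtRecord13CoPHOfSect3Sentences (EjSub_unit smearedWilson_unit)

/-! ## §1. Enlarging the constants of (2.43) ∕ (2.44) on a carrier with non-negative volumes -/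

/-- On a carrier with non-negative volumes, (2.43) with `E₁` gives (2.43) with any `E₁′ ≥ E₁` (`L ≥ 0`). [cite: Balaban1988Convergent, (2.43) p.263 (bookkeeping)] -/
theorem ineq243_mono_const (S : B14.Sect2Data) {L β E₁ E₁' : ℝ} (hL : 0 ≤ L) (hvol : ∀ n ω, 0 ≤ S.gammaVol n ω) (hE : E₁ ≤ E₁')
    (h : Ineq243 S L β E₁) : Ineq243 S L β E₁' := fun j k ω hj hjk hk =>
  (h j k ω hj hjk hk).trans (mul_le_mul_of_nonneg_right hE
    (Finset.sum_nonneg fun n _ => mul_nonneg (Real.rpow_nonneg (Real.rpow_nonneg hL _) _) (hvol n ω)))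

/-- On a carrier with non-negative volumes and couplings, (2.44) with `R₁` gives (2.44) with any `R₁′ ≥ R₁`. [cite: Balaban1988Convergent, (2.44) p.263 (bookkeeping)] -/
theorem ineq244_mono_const (S : B14.Sect2Data) {R₁ R₁' : ℝ} {κ₀ : ℕ} (hg : ∀ j, j ≤ S.K → 0 ≤ S.flow.g j) (hvol : ∀ n ω, 0 ≤ S.gammaVol n ω) (hR : R₁ ≤ R₁')
    (h : Ineq244 S R₁ κ₀) : Ineq244 S R₁' κ₀ := fun j k ω hj hjk hk =>
  (h j k ω hj hjk hk).trans (by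
    rw [mul_assoc, mul_assoc]
    exact mul_le_mul_of_nonneg_right hR (mul_nonneg (pow_nonneg (hg j (hjk.trans hk)) _) (Finset.sum_nonneg fun n _ => hvol n ω)))

/-- A (2.43)-type binder is monotone in the volumes (`E₁ ≥ 0`, `L ≥ 0`). [cite: Balaban1988Convergent, (2.43) p.263 (bookkeeping)] -/
theorem h243_mono_vol {E₁ L β x : ℝ} (hE : 0 ≤ E₁) (hL : 0 ≤ L) {j k : ℕ} (hj : 1 ≤ j) {V Γ : ℕ → ℝ} (hVΓ : ∀ n, 1 ≤ n → n ≤ k → V n ≤ Γ n)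
    (h : x ≤ E₁ * ∑ n ∈ Icc j k, (L ^ ((j : ℝ) - n)) ^ β * V n) : x ≤ E₁ * ∑ n ∈ Icc j k, (L ^ ((j : ℝ) - n)) ^ β * Γ n :=
  h.trans (mul_le_mul_of_nonneg_left (Finset.sum_le_sum fun n hn =>
    mul_le_mul_of_nonneg_left (hVΓ n (hj.trans (Finset.mem_Icc.mp hn).1) (Finset.mem_Icc.mp hn).2) (Real.rpow_nonneg (Real.rpow_nonneg hL _) _)) hE)

/-- A (2.44)-type binder is monotone in the volumes (`R₁·g_j^{κ₀} ≥ 0`). [cite: Balaban1988Convergent, (2.44) p.263 (bookkeeping)] -/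
theorem h244_mono_vol {R₁ g x : ℝ} {κ₀ : ℕ} (hR : 0 ≤ R₁) (hg : 0 ≤ g) {j k : ℕ} (hj : 1 ≤ j) {V Γ : ℕ → ℝ} (hVΓ : ∀ n, 1 ≤ n → n ≤ k → V n ≤ Γ n)
    (h : x ≤ R₁ * g ^ κ₀ * ∑ n ∈ Icc j k, V n) : x ≤ R₁ * g ^ κ₀ * ∑ n ∈ Icc j k, Γ n :=
  h.trans (mul_le_mul_of_nonneg_left (Finset.sum_le_sum fun n hn =>
    hVΓ n (hj.trans (Finset.mem_Icc.mp hn).1) (Finset.mem_Icc.mp hn).2) (mul_nonneg hR (pow_nonneg hg _)))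

/-! ## §2. PRODUCE: Theorem 2 on the keyed carrier from [III] §3's per-point ∕ per-domain sentences -/

section Produce

variable {F : T4Family} {N : ℕ} [NeZero N]
variable (θ : Stage13HParams F N) (p : B12.RunParams)
variable (𝒯 : (k : ℕ) → SeqOfRecord F θ.ν θ.τ9.M (gOfRecord₁₃ F N θ.toStage13Params p) p.K k → Sect2.TermValues (F.P p.K) (MatA N) (FluctV N) θ.τ9.M)
variable (𝒰 : (k : ℕ) → SeqOfRecord F θ.ν θ.τ9.M (gOfRecord₁₃ F N θ.toStage13Params p) p.K k → Set (GaugeField (F.P p.K) 0 (SU N)))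

open Classical in
/-- **★★ (2.43) ON THE KEYED CARRIER FROM (3.65) + (3.67) PER POINT AT EVERY DATUM** (one run; `E₁ = cE`, exponent `β = 1 − b`, `L = F.L`): the per-datum hypothesis is [III]'s
§3 analysis of 𝐄 for the witness `𝒯 k s` at the configuration `U ∈ 𝒰 k s` — a partition `φ_j(s) = Σ_{z∈Z} h_z` ((3.65)) whose points exhaust the (2.26)–(2.27) range and lie in
`Ω_j(s)`, and (3.67) per point `z` of scale `n` (`z ∈ Γ_n(s)`, `j ≤ n ≤ k`) with constant `cE` and exponent `5 − b`; the p. 263 count is g0 FILE 9's THEOREM.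
[cite: Balaban1988Convergent, Thm 2 (2.43) p.263, (3.65)–(3.67) p.283, p.263 (count), (2.1)–(2.2) pp.254–255] -/
theorem ineq243_keyed_of_sect3E {b cE : ℝ} (hcE : 0 ≤ cE)
    (hE : ∀ k, k ≤ p.K → ∀ (s : SeqOfRecord F θ.ν θ.τ9.M (gOfRecord₁₃ F N θ.toStage13Params p) p.K k) (U : GaugeField (F.P p.K) 0 (SU N)), U ∈ 𝒰 k s →
      ∀ j, 1 ≤ j → j ≤ k → ∃ (Z : Finset (Site (F.P p.K) j)) (h : Site (F.P p.K) j → Plaq (F.P p.K) 0 → ℝ),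
        (∀ q, θ.Phih p k s.Ω s.Λ j q = ∑ z ∈ Z, h z q) ∧
        (∀ z, z ∉ Z → ∀ X, Sect2.admE (F.P p.K) θ.ν θ.τ9.M (gOfRecord₁₃ F N θ.toStage13Params p) s.Λ j (Sect2.domSites (F.P p.K) θ.τ9.M j X) z = false) ∧
        (∀ z ∈ Z, toFine j z ∈ s.Ω j) ∧
        (∀ z ∈ Z, ∀ n, j ≤ n → n ≤ k → toFine j z ∈ gammaRegion s.Ω k n →
          |(∑ X : (Sect2.domSys (F.P p.K) θ.τ9.M j).Dom,
              (if Sect2.admE (F.P p.K) θ.ν θ.τ9.M (gOfRecord₁₃ F N θ.toStage13Params p) s.Λ j (Sect2.domSites (F.P p.K) θ.τ9.M j X) z then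
                (((𝒯 k s).E j X z (gOfRecord₁₃ F N θ.toStage13Params p (j - 1)) (Sect2.ofBackgroundC (ιSU N) U)).re -
                  ((𝒯 k s).E j X z (gOfRecord₁₃ F N θ.toStage13Params p (j - 1)) (Sect2.ofBackgroundC (ιSU N) 1)).re) else 0))
            - (1 / gOfRecord₁₃ F N θ.toStage13Params p (j - 1) ^ 2 - 1 / gOfRecord₁₃ F N θ.toStage13Params p j ^ 2) * smearedWilson (h z) U| ≤
            cE * (((F.P p.K).L : ℝ) ^ ((j : ℝ) - n)) ^ (5 - b))) :
    Ineq243 (sect2DataOfRecord₁₃Keyed θ p 𝒯 𝒰) ((F.P p.K).L : ℝ) (1 - b) cE := by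
  have hL : (1 : ℝ) < ((F.P p.K).L : ℝ) := by exact_mod_cast (F.P p.K).hL.2
  refine ineq243_keyed_of_h243 θ p 𝒯 𝒰 (by positivity) hcE fun k hk s U hU j hj hjk => ?_
  have hkmK : k ≤ (F.P p.K).m + (F.P p.K).K := by rw [T4Family.P_K]; omega
  obtain ⟨Z, h, hφ, hZ, hZΩ, h367⟩ := hE k hk s U hU j hj hjk
  -- the canonical scale of a point of `Ω_j(s)` (as g0 FILE 11)
  have hsc : ∃ sc : Site (F.P p.K) j → ℕ, ∀ z ∈ Z, (j ≤ sc z ∧ sc z ≤ k) ∧ toFine j z ∈ gammaRegion s.Ω k (sc z) := by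
    refine ⟨fun z => if hz : z ∈ Z then Classical.choose (exists_scale_of_mem_Omega θ p s hj hjk (hZΩ z hz)) else j, fun z hz => ?_⟩
    simp only [dif_pos hz]
    obtain ⟨h1, h2, h3⟩ := Classical.choose_spec (exists_scale_of_mem_Omega θ p s hj hjk (hZΩ z hz))
    exact ⟨⟨h1, h2⟩, h3⟩
  obtain ⟨sc, hscP⟩ := hsc
  refine h243_at_record₁₃CoPH_of_perPoint θ p s (𝒯 k s) U j Z h hφ hZ sc (fun z hz => (hscP z hz).1) (lt_trans zero_lt_one hL) hcE
    (fun z hz => h367 z hz (sc z) (hscP z hz).1.1 (hscP z hz).1.2 (hscP z hz).2) _ fun n => ?_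
  by_cases hn : j ≤ n ∧ n ≤ k
  · exact hcount_at_record₁₃ θ p s hj hn.1 (hn.2.trans hkmK) Z sc fun z hz hzn => by rw [← hzn]; exact (hscP z hz).2
  · have h0 : (Z.filter fun z => sc z = n) = ∅ := by
      refine Finset.filter_false_of_mem fun z hz hzn => hn ?_
      rw [← hzn]; exact (hscP z hz).1
    rw [h0, Finset.card_empty, Nat.cast_zero]
    exact mul_nonneg (Real.rpow_nonneg (Real.rpow_nonneg (by positivity) _) _) (Nat.cast_nonneg _)

open Classical in
/-- **★★ (2.44) ON THE KEYED CARRIER FROM p. 283 PER DOMAIN AT EVERY DATUM** (one run; `R₁ = cR·K₀(4·2^d, 2d)`): the per-datum hypothesis is [III]'s §3 analysis of 𝐑 for the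
witness `𝒯 k s` at `U ∈ 𝒰 k s` — every (2.30)-admissible `X ∈ 𝐃_j` carries a chosen cube `pick X ∈ X` of a scale `sc ∈ [j, k]` with the cube inside `Γ_{sc}(s)` and p. 283's
bound «O(1)(LʲL⁻ⁿ)⁴ g_j^{κ₀} exp(−κ d_j(X))» with ONE `cR` and `κ ≥ κ₀(4·2^d, 2d)`; [II] (1.26) on the torus and the cube count are THEOREMS (g0 FILES 3, 10); couplings `g_j ≥ 0` (`j ≤ K`), `1 ≤ M`.
[cite: Balaban1988Convergent, Thm 2 (2.44) p.263, p.283, (2.30) p.260; Balaban1988RG2Cluster, (1.26) p.8] -/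
theorem ineq244_keyed_of_sect3R (hM : 1 ≤ θ.τ9.M) (hg : ∀ j, j ≤ p.K → 0 ≤ gOfRecord₁₃ F N θ.toStage13Params p j) {κ cR : ℝ} {κ₀ : ℕ} (hcR : 0 ≤ cR)
    (hκR : kappa₀ (4 * 2 ^ (F.P p.K).d) (2 * (F.P p.K).d) ≤ κ)
    (hR : ∀ k, k ≤ p.K → ∀ (s : SeqOfRecord F θ.ν θ.τ9.M (gOfRecord₁₃ F N θ.toStage13Params p) p.K k) (U : GaugeField (F.P p.K) 0 (SU N)), U ∈ 𝒰 k s →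
      ∀ j, 1 ≤ j → j ≤ k →
        ∃ (pick : (Sect2.domSys (F.P p.K) θ.τ9.M j).Dom → TPt (F.P p.K).d (Sect2.domCount (F.P p.K) θ.τ9.M j))
          (sc : TPt (F.P p.K).d (Sect2.domCount (F.P p.K) θ.τ9.M j) → ℕ),
          (∀ X, Sect2.admR (F.P p.K) θ.ν θ.τ9.M (gOfRecord₁₃ F N θ.toStage13Params p) s.Λ j (Sect2.domSites (F.P p.K) θ.τ9.M j X) = true →
            pick X ∈ X.1 ∧ (j ≤ sc (pick X) ∧ sc (pick X) ≤ k) ∧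
              cubeEnl (F.P p.K) (side (F.P p.K).L θ.τ9.M j) (Sect2.liftIdx (F.P p.K) (pick X)) 0 ⊆ gammaRegion s.Ω k (sc (pick X)) ∧
              |((𝒯 k s).R j X (Sect2.ofBackgroundC (ιSU N) U)).re - ((𝒯 k s).R j X (Sect2.ofBackgroundC (ιSU N) 1)).re| ≤
                cR * (((F.P p.K).L : ℝ) ^ ((j : ℝ) - sc (pick X))) ^ 4 * (gOfRecord₁₃ F N θ.toStage13Params p j) ^ κ₀ *
                  Real.exp (-κ * (Sect2.domSys (F.P p.K) θ.τ9.M j).dj X))) :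
    Ineq244 (sect2DataOfRecord₁₃Keyed θ p 𝒯 𝒰) (cR * K₀ (4 * 2 ^ (F.P p.K).d) (2 * (F.P p.K).d)) κ₀ := by
  have hL : (1 : ℝ) < ((F.P p.K).L : ℝ) := by exact_mod_cast (F.P p.K).hL.2
  have hK : 0 ≤ K₀ (4 * 2 ^ (F.P p.K).d) (2 * (F.P p.K).d) := (K₀_pos _ _).le
  refine ineq244_keyed_of_h244 θ p 𝒯 𝒰 (mul_nonneg hcR hK) hg fun k hk s U hU j hj hjk => ?_
  have hkmK : k ≤ (F.P p.K).m + (F.P p.K).K := by rw [T4Family.P_K]; omega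
  obtain ⟨pick, sc, hX⟩ := hR k hk s U hU j hj hjk
  refine h244_at_record₁₃CoPH_of_perDomain θ p s (𝒯 k s) U j pick (fun X hXa => (hX X hXa).1) sc (fun X hXa => (hX X hXa).2.1) hκR hcR (lt_trans zero_lt_one hL)
    (hg j (hjk.trans hk)) (fun X hXa => (hX X hXa).2.2.2) _ fun n => ?_
  by_cases hn : j ≤ n ∧ n ≤ k
  · refine hcountR_at_record₁₃ θ p s hj hn.1 (hn.2.trans hkmK) hM _ sc fun x hx hxn => ?_
    obtain ⟨X, hXm, rfl⟩ := Finset.mem_image.mp hx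
    rw [← hxn]; exact (hX X (Finset.mem_filter.mp hXm).2).2.2.1
  · have h0 : (((univ.filter fun X => Sect2.admR (F.P p.K) θ.ν θ.τ9.M (gOfRecord₁₃ F N θ.toStage13Params p) s.Λ j
        (Sect2.domSites (F.P p.K) θ.τ9.M j X) = true).image pick).filter fun z => sc z = n) = ∅ := by
      refine Finset.filter_false_of_mem fun x hx hxn => hn ?_
      obtain ⟨X, hXm, rfl⟩ := Finset.mem_image.mp hx
      rw [← hxn]; exact (hX X (Finset.mem_filter.mp hXm).2).2.1
    rw [h0, Finset.card_empty, Nat.cast_zero]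
    exact mul_nonneg (Real.rpow_nonneg (Real.rpow_nonneg (by positivity) _) _) (Nat.cast_nonneg _)

end Produce

section Family

variable {F : T4Family} {N : ℕ} [NeZero N]

open Classical in
/-- **★★★ THEOREM 2 BY NAME AT THE ₁₃ OBJECTS, PRODUCED: `B14.Thm2Printed` ON A FAMILY OF KEYED CARRIERS FROM [III] §3's SENTENCES with constants uniform over the family**
(the printed «there exists a constant E₁ independent of j, k, Ω, {Ω_j}, {Λ_j}, T», «an absolute constant R₁» = the order of quantifiers: the E-side data for every `b > 0` with
`cE` uniform in the run index `i` («The constant E₁ depends on β also»), the R-side data with uniform `cR, κ`).  `L = F.L`; `E₁ := cE(1 − β)`, `R₁ := cR·K₀(4·2⁴, 8)`.  The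
hypothesis parameter `H033` and (0.20) are not used by the summation (the data carry the content). [cite: Balaban1988Convergent, Thm 2 (2.43)–(2.44) p.263, (3.65)–(3.67) p.283, p.283] -/
theorem thm2Printed_keyed_of_sect3Sentences {ι : Type} (θ : ι → Stage13HParams F N) (p : ι → B12.RunParams)
    (𝒯 : (i : ι) → (k : ℕ) → SeqOfRecord F (θ i).ν (θ i).τ9.M (gOfRecord₁₃ F N (θ i).toStage13Params (p i)) (p i).K k →
      Sect2.TermValues (F.P (p i).K) (MatA N) (FluctV N) (θ i).τ9.M)
    (𝒰 : (i : ι) → (k : ℕ) → SeqOfRecord F (θ i).ν (θ i).τ9.M (gOfRecord₁₃ F N (θ i).toStage13Params (p i)) (p i).K k → Set (GaugeField (F.P (p i).K) 0 (SU N)))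
    (H033 : Flow → ℕ → Prop) (β : ℝ) (κ₀ : ℕ) (hM : ∀ i, 1 ≤ (θ i).τ9.M) (hg : ∀ i j, j ≤ (p i).K → 0 ≤ gOfRecord₁₃ F N (θ i).toStage13Params (p i) j)
    -- (𝐄): for every b > 0, ONE cE for the whole family
    (hE : ∀ b : ℝ, 0 < b → ∃ cE : ℝ, 0 ≤ cE ∧ ∀ i, ∀ k, k ≤ (p i).K →
      ∀ (s : SeqOfRecord F (θ i).ν (θ i).τ9.M (gOfRecord₁₃ F N (θ i).toStage13Params (p i)) (p i).K k) (U : GaugeField (F.P (p i).K) 0 (SU N)), U ∈ 𝒰 i k s →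
      ∀ j, 1 ≤ j → j ≤ k → ∃ (Z : Finset (Site (F.P (p i).K) j)) (h : Site (F.P (p i).K) j → Plaq (F.P (p i).K) 0 → ℝ),
        (∀ q, (θ i).Phih (p i) k s.Ω s.Λ j q = ∑ z ∈ Z, h z q) ∧
        (∀ z, z ∉ Z → ∀ X, Sect2.admE (F.P (p i).K) (θ i).ν (θ i).τ9.M (gOfRecord₁₃ F N (θ i).toStage13Params (p i)) s.Λ j
          (Sect2.domSites (F.P (p i).K) (θ i).τ9.M j X) z = false) ∧
        (∀ z ∈ Z, toFine j z ∈ s.Ω j) ∧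
        (∀ z ∈ Z, ∀ n, j ≤ n → n ≤ k → toFine j z ∈ gammaRegion s.Ω k n →
          |(∑ X : (Sect2.domSys (F.P (p i).K) (θ i).τ9.M j).Dom,
              (if Sect2.admE (F.P (p i).K) (θ i).ν (θ i).τ9.M (gOfRecord₁₃ F N (θ i).toStage13Params (p i)) s.Λ j (Sect2.domSites (F.P (p i).K) (θ i).τ9.M j X) z then
                (((𝒯 i k s).E j X z (gOfRecord₁₃ F N (θ i).toStage13Params (p i) (j - 1)) (Sect2.ofBackgroundC (ιSU N) U)).re -
                  ((𝒯 i k s).E j X z (gOfRecord₁₃ F N (θ i).toStage13Params (p i) (j - 1)) (Sect2.ofBackgroundC (ιSU N) 1)).re) else 0))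
            - (1 / gOfRecord₁₃ F N (θ i).toStage13Params (p i) (j - 1) ^ 2 - 1 / gOfRecord₁₃ F N (θ i).toStage13Params (p i) j ^ 2) * smearedWilson (h z) U| ≤
            cE * ((F.L : ℝ) ^ ((j : ℝ) - n)) ^ (5 - b)))
    -- (𝐑): ONE cR, κ for the whole family
    (hR : ∃ cR κ : ℝ, 0 ≤ cR ∧ kappa₀ (4 * 2 ^ 4) (2 * 4) ≤ κ ∧ ∀ i, ∀ k, k ≤ (p i).K →
      ∀ (s : SeqOfRecord F (θ i).ν (θ i).τ9.M (gOfRecord₁₃ F N (θ i).toStage13Params (p i)) (p i).K k) (U : GaugeField (F.P (p i).K) 0 (SU N)), U ∈ 𝒰 i k s →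
      ∀ j, 1 ≤ j → j ≤ k →
        ∃ (pick : (Sect2.domSys (F.P (p i).K) (θ i).τ9.M j).Dom → TPt (F.P (p i).K).d (Sect2.domCount (F.P (p i).K) (θ i).τ9.M j))
          (sc : TPt (F.P (p i).K).d (Sect2.domCount (F.P (p i).K) (θ i).τ9.M j) → ℕ),
          (∀ X, Sect2.admR (F.P (p i).K) (θ i).ν (θ i).τ9.M (gOfRecord₁₃ F N (θ i).toStage13Params (p i)) s.Λ j (Sect2.domSites (F.P (p i).K) (θ i).τ9.M j X) = true →
            pick X ∈ X.1 ∧ (j ≤ sc (pick X) ∧ sc (pick X) ≤ k) ∧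
              cubeEnl (F.P (p i).K) (side (F.P (p i).K).L (θ i).τ9.M j) (Sect2.liftIdx (F.P (p i).K) (pick X)) 0 ⊆ gammaRegion s.Ω k (sc (pick X)) ∧
              |((𝒯 i k s).R j X (Sect2.ofBackgroundC (ιSU N) U)).re - ((𝒯 i k s).R j X (Sect2.ofBackgroundC (ιSU N) 1)).re| ≤
                cR * ((F.L : ℝ) ^ ((j : ℝ) - sc (pick X))) ^ 4 * (gOfRecord₁₃ F N (θ i).toStage13Params (p i) j) ^ κ₀ *
                  Real.exp (-κ * (Sect2.domSys (F.P (p i).K) (θ i).τ9.M j).dj X))) :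
    B14.Thm2Printed H033 (fun i => sect2DataOfRecord₁₃Keyed (θ i) (p i) (𝒯 i) (𝒰 i)) (F.L : ℝ) β κ₀ := by
  intro hβ
  obtain ⟨cE, hcE, hEi⟩ := hE (1 - β) (by linarith)
  obtain ⟨cR, κ, hcR, hκR, hRi⟩ := hR
  refine ⟨cE, cR * K₀ (4 * 2 ^ 4) (2 * 4), fun i _ _ => ⟨?_, ?_⟩⟩
  · have h := ineq243_keyed_of_sect3E (θ i) (p i) (𝒯 i) (𝒰 i) (b := 1 - β) hcE (hEi i)
    rw [sub_sub_cancel] at h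
    exact h
  · exact ineq244_keyed_of_sect3R (θ i) (p i) (𝒯 i) (𝒰 i) (hM i) (hg i) hcR hκR (hRi i)

end Family

/-! ## §3. CONSUME: Theorem 2 on the keyed carrier ⇒ (2.49) for r11's (2.23)-action of record at every datum -/

section Consume

variable {F : T4Family} {N : ℕ} [NeZero N]
variable (θ : Stage13HParams F N) (p : B12.RunParams)
variable (𝒯 : (k : ℕ) → SeqOfRecord F θ.ν θ.τ9.M (gOfRecord₁₃ F N θ.toStage13Params p) p.K k → Sect2.TermValues (F.P p.K) (MatA N) (FluctV N) θ.τ9.M)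
variable (𝒰 : (k : ℕ) → SeqOfRecord F θ.ν θ.τ9.M (gOfRecord₁₃ F N θ.toStage13Params p) p.K k → Set (GaugeField (F.P p.K) 0 (SU N)))

/-- **`B14.Thm2Printed` OF RECORD, KEYED ⇒ NON-NEGATIVE CONSTANTS `E₁, R₁` WITH (2.43) ∧ (2.44) ON THE KEYED CARRIER** (under print's guard `β < 1`, the hypothesis parameter
`H033` of Theorem 1 at the run's flow, `L ≥ 0`, couplings `≥ 0`; (0.20) is free; the constants are made non-negative by §1). [cite: Balaban1988Convergent, Thm 2 (2.43)–(2.44) p.263] -/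
theorem exists_nonneg_constants_of_thm2Printed_keyed (H033 : Flow → ℕ → Prop) {L β : ℝ} {κ₀ : ℕ}
    (h : B14.Thm2Printed H033 (fun _ : PUnit => sect2DataOfRecord₁₃Keyed θ p 𝒯 𝒰) L β κ₀) (hβ : β < 1)
    (h033 : H033 (flowOfRun (gOfRecord₁₃ F N θ.toStage13Params p)) p.K) (hL : 0 ≤ L) (hg : ∀ j, j ≤ p.K → 0 ≤ gOfRecord₁₃ F N θ.toStage13Params p j) :
    ∃ E₁ R₁ : ℝ, 0 ≤ E₁ ∧ 0 ≤ R₁ ∧ Ineq243 (sect2DataOfRecord₁₃Keyed θ p 𝒯 𝒰) L β E₁ ∧ Ineq244 (sect2DataOfRecord₁₃Keyed θ p 𝒯 𝒰) R₁ κ₀ := by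
  obtain ⟨E₁, R₁, hall⟩ := h hβ
  obtain ⟨h243, h244⟩ := hall PUnit.unit (sect2DataOfRecord₁₃Keyed_satisfiesRG θ p 𝒯 𝒰) h033
  refine ⟨max E₁ 0, max R₁ 0, le_max_right _ _, le_max_right _ _, ?_, ?_⟩
  · exact ineq243_mono_const _ hL (gammaVol_nonneg θ p 𝒯 𝒰) (le_max_left _ _) h243
  · exact ineq244_mono_const _ hg (gammaVol_nonneg θ p 𝒯 𝒰) (le_max_left _ _) h244

open Classical in
/-- **★★ (2.43) ∧ (2.44) ON THE KEYED CARRIER ⇒ (2.49) FOR THE (2.23)-ACTION OF RECORD AT EVERY DATUM** `(k ≤ K, s, U ∈ 𝒰 k s)`, witness `𝒯 k s`, any volumes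
`Γ_n ≥ |Γ_n(s)|` (`n = 1,…,k`; e.g. `|Γ_n(s)|` itself, or g0 FILE 13's `|Γ_n(s)| + #ring_n(s)`): g0 FILE 1's ★★ `ineq249_action23_at_record₁₃CoPH_of_thm2` with its Theorem-2
binders `h243 ∕ h244` DISCHARGED from the carrier sentences (`h243_of_ineq243_keyed`, `h244_of_ineq244_keyed`, monotone in the volumes); displayed stay (2.48) `h248`, (2.46)'s
coupling inputs `hsum ∕ hsmall` (κ₀ ≥ 7), the vacuum sentence, all at the volumes `Γ`.  Replaces g0 FILE 8's `ineq249_action23_at_record₁₃CoPH_of_ineq243OfRecord`, whose carrier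
hypothesis step 1 refutes. [cite: Balaban1988Convergent, Thm 2 (2.43)–(2.44) p.263, (2.45)–(2.49) pp.263–264] -/
theorem ineq249_action23_of_ineq243_ineq244_keyed {L β E₁ R₁ : ℝ} {κ₀ : ℕ}
    (h243K : Ineq243 (sect2DataOfRecord₁₃Keyed θ p 𝒯 𝒰) L β E₁) (h244K : Ineq244 (sect2DataOfRecord₁₃Keyed θ p 𝒯 𝒰) R₁ κ₀)
    (hL : 1 < L) (hβ : 0 < β) (hE : 0 ≤ E₁) (hR : 0 ≤ R₁) (hκ : 7 ≤ κ₀)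
    {k : ℕ} (hk : k ≤ p.K) (s : SeqOfRecord F θ.ν θ.τ9.M (gOfRecord₁₃ F N θ.toStage13Params p) p.K k) (U : GaugeField (F.P p.K) 0 (SU N)) (hU : U ∈ 𝒰 k s)
    (hg : ∀ j, j ≤ p.K → 0 ≤ gOfRecord₁₃ F N θ.toStage13Params p j)
    (a : Tk.SFluct (F.P p.K) (FluctV N)) (Ek EkLog EkRest : ℝ) (hEk : Ek = EkLog + EkRest) (B₁ E₂ : ℝ) (Γ : ℕ → ℝ)
    (hΓ : ∀ n, 1 ≤ n → n ≤ k → ((univ.filter fun y : Site (F.P p.K) n => toFine n y ∈ gammaRegion s.Ω k n).card : ℝ) ≤ Γ n)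
    (hsum : ∀ n, 1 ≤ n → n ≤ k → ∑ j ∈ Icc 1 n, (gOfRecord₁₃ F N θ.toStage13Params p j) ^ κ₀ ≤ (gOfRecord₁₃ F N θ.toStage13Params p n) ^ (κ₀ - 6))
    (hsmall : ∀ n, 1 ≤ n → n ≤ k → R₁ * (gOfRecord₁₃ F N θ.toStage13Params p n) ^ (κ₀ - 6) ≤ 1)
    (h248 : |B240 (sect2TowerOfRecord F N (FluctV N) p.K (settingOfRecord₁₃ F N θ.toStage13Params p) (θ.rzAt p s) s (𝒯 k s))
        (fun j X => Sect2.admB (F.P p.K) θ.ν θ.τ9.M (gOfRecord₁₃ F N θ.toStage13Params p) s.Ω s.Λ j (Sect2.domSites (F.P p.K) θ.τ9.M j X)) a k U| ≤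
      2 * B₁ * ∑ n ∈ Icc 1 k, Γ n)
    (hvac : VacuumRestBound EkRest E₂ Γ k) :
    Ineq249 ((sect2ActionDataOfRecord F N (FluctV N) p.K (settingOfRecord₁₃ F N θ.toStage13Params p) (θ.rzAt p s) s (𝒯 k s) a Ek).action23 k U)
      (smearedWilson (invSq (flowOfRun (gOfRecord₁₃ F N θ.toStage13Params p)) (θ.Phih p k s.Ω s.Λ) k) U) (-EkLog)
      (E₁ * (1 - L ^ (-β))⁻¹ + 1 + 2 * B₁ + E₂) Γ k :=
  have hL0 : 0 ≤ L := le_of_lt (lt_trans zero_lt_one hL)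
  have hΓ0 : ∀ n, 1 ≤ n → n ≤ k → 0 ≤ Γ n := fun n hn hnk => (Nat.cast_nonneg _).trans (hΓ n hn hnk)
  ineq249_action23_at_record₁₃CoPH_of_thm2 θ p s (𝒯 k s) a κ₀ hκ Ek EkLog EkRest hEk U E₁ R₁ B₁ L β E₂ Γ hL hβ hE hR hΓ0
    (fun j hj hjk => h243_mono_vol hE hL0 hj hΓ (h243_of_ineq243_keyed θ p 𝒯 𝒰 h243K hk s U hU j hj hjk))
    (fun j hj hjk => h244_mono_vol hR (hg j (hjk.trans hk)) hj hΓ (h244_of_ineq244_keyed θ p 𝒯 𝒰 h244K hk s U hU j hj hjk)) hsum hsmall h248 hvac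

open Classical in
/-- **★★ THEOREM 2 OF RECORD (KEYED) ⇒ (2.49)**: under `0 < β < 1`, `1 < L`, `κ₀ ≥ 7`, the hypothesis parameter `H033` at the run's flow and non-negative couplings,
`B14.Thm2Printed` on the keyed carrier yields constants `E₁, R₁ ≥ 0` such that AT EVERY DATUM `(k ≤ K, s, U ∈ 𝒰 k s)` and volumes `Γ_n ≥ |Γ_n(s)|`, given (2.46)'s
`R₁`-smallness `R₁ g_n^{κ₀−6} ≤ 1` and `Σ_{j≤n} g_j^{κ₀} ≤ g_n^{κ₀−6}`, the boundary bound (2.48) and the vacuum sentence at `Γ`, (2.49) holds for the (2.23)-action of `(s, 𝒯 k s)`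
with `O(1) = E₁(1−L^{−β})⁻¹ + 1 + 2B₁ + E₂` («In fact the constant R₁ can be taken as equal to 1 for g_j sufficiently small» — the smallness is displayed, `R₁`-dependent as
printed). [cite: Balaban1988Convergent, Thm 2 p.263, (2.45)–(2.49) pp.263–264] -/
theorem ineq249_action23_of_thm2Printed_keyed (H033 : Flow → ℕ → Prop) {L β : ℝ} {κ₀ : ℕ}
    (h : B14.Thm2Printed H033 (fun _ : PUnit => sect2DataOfRecord₁₃Keyed θ p 𝒯 𝒰) L β κ₀) (hβ1 : β < 1) (hβ0 : 0 < β) (hL : 1 < L) (hκ : 7 ≤ κ₀)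
    (h033 : H033 (flowOfRun (gOfRecord₁₃ F N θ.toStage13Params p)) p.K) (hg : ∀ j, j ≤ p.K → 0 ≤ gOfRecord₁₃ F N θ.toStage13Params p j) :
    ∃ E₁ R₁ : ℝ, 0 ≤ E₁ ∧ 0 ≤ R₁ ∧
      ∀ k, k ≤ p.K → ∀ (s : SeqOfRecord F θ.ν θ.τ9.M (gOfRecord₁₃ F N θ.toStage13Params p) p.K k) (U : GaugeField (F.P p.K) 0 (SU N)), U ∈ 𝒰 k s →
      ∀ (a : Tk.SFluct (F.P p.K) (FluctV N)) (Ek EkLog EkRest : ℝ), Ek = EkLog + EkRest → ∀ (B₁ E₂ : ℝ) (Γ : ℕ → ℝ),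
      (∀ n, 1 ≤ n → n ≤ k → ((univ.filter fun y : Site (F.P p.K) n => toFine n y ∈ gammaRegion s.Ω k n).card : ℝ) ≤ Γ n) →
      (∀ n, 1 ≤ n → n ≤ k → ∑ j ∈ Icc 1 n, (gOfRecord₁₃ F N θ.toStage13Params p j) ^ κ₀ ≤ (gOfRecord₁₃ F N θ.toStage13Params p n) ^ (κ₀ - 6)) →
      (∀ n, 1 ≤ n → n ≤ k → R₁ * (gOfRecord₁₃ F N θ.toStage13Params p n) ^ (κ₀ - 6) ≤ 1) →
      |B240 (sect2TowerOfRecord F N (FluctV N) p.K (settingOfRecord₁₃ F N θ.toStage13Params p) (θ.rzAt p s) s (𝒯 k s))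
          (fun j X => Sect2.admB (F.P p.K) θ.ν θ.τ9.M (gOfRecord₁₃ F N θ.toStage13Params p) s.Ω s.Λ j (Sect2.domSites (F.P p.K) θ.τ9.M j X)) a k U| ≤
        2 * B₁ * ∑ n ∈ Icc 1 k, Γ n →
      VacuumRestBound EkRest E₂ Γ k →
      Ineq249 ((sect2ActionDataOfRecord F N (FluctV N) p.K (settingOfRecord₁₃ F N θ.toStage13Params p) (θ.rzAt p s) s (𝒯 k s) a Ek).action23 k U)
        (smearedWilson (invSq (flowOfRun (gOfRecord₁₃ F N θ.toStage13Params p)) (θ.Phih p k s.Ω s.Λ) k) U) (-EkLog)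
        (E₁ * (1 - L ^ (-β))⁻¹ + 1 + 2 * B₁ + E₂) Γ k := by
  obtain ⟨E₁, R₁, hE, hR, h243K, h244K⟩ :=
    exists_nonneg_constants_of_thm2Printed_keyed θ p 𝒯 𝒰 H033 h hβ1 h033 (le_of_lt (lt_trans zero_lt_one hL)) hg
  exact ⟨E₁, R₁, hE, hR, fun k hk s U hU a Ek EkLog EkRest hEk B₁ E₂ Γ hΓ hsum hsmall h248 hvac =>
    ineq249_action23_of_ineq243_ineq244_keyed θ p 𝒯 𝒰 h243K h244K hL hβ0 hE hR hκ hk s U hU hg a Ek EkLog EkRest hEk B₁ E₂ Γ hΓ hsum hsmall h248 hvac⟩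

end Consume

/-! ## §4. A6: the keyed Theorem 2 of record is CONSISTENT — the unit class -/

section A6

variable {F : T4Family} {N : ℕ} [NeZero N]
variable (θ : Stage13HParams F N) (p : B12.RunParams)
variable (𝒯 : (k : ℕ) → SeqOfRecord F θ.ν θ.τ9.M (gOfRecord₁₃ F N θ.toStage13Params p) p.K k → Sect2.TermValues (F.P p.K) (MatA N) (FluctV N) θ.τ9.M)

/-- **(2.43) holds on the keyed carrier of the UNIT CLASS `𝒰 ≡ {1}` with `E₁ = 0`, for every witness family**: at `U = 1` the vacuum-subtracted 𝐄-sum and `A(φ_j, 1)` vanish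
(g0 FILE 7's `EjSub_unit`, `smearedWilson_unit`). [cite: Balaban1988Convergent, (2.43) p.263, (2.25) p.259 (bookkeeping)] -/
theorem ineq243_keyed_unitClass (L β : ℝ) :
    Ineq243 (sect2DataOfRecord₁₃Keyed θ p 𝒯 (fun _ _ => {1})) L β 0 := by
  intro j k ω hj hjk hk
  obtain ⟨k', d⟩ := ω
  rw [zero_mul]
  by_cases hk' : k' = k
  · subst hk'
    have hU : d.U = 1 := d.mem
    rw [eTerm_mk_self, hU, EjSub_unit, smearedWilson_unit, mul_zero, sub_zero, abs_zero]
  · rw [eTerm_mk_of_ne θ p 𝒯 _ hk', abs_zero]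

open Classical in
/-- **(2.44) holds on the keyed carrier of the unit class with `R₁ = 0`, for every witness family** (`𝐑^{(j)}(X,(ι1,0)) − 𝐑^{(j)}(X,(ι1,0)) = 0`).
[cite: Balaban1988Convergent, (2.44) p.263, (2.30) p.260 (bookkeeping)] -/
theorem ineq244_keyed_unitClass (κ₀ : ℕ) :
    Ineq244 (sect2DataOfRecord₁₃Keyed θ p 𝒯 (fun _ _ => {1})) 0 κ₀ := by
  intro j k ω hj hjk hk
  obtain ⟨k', d⟩ := ω
  rw [zero_mul, zero_mul]
  by_cases hk' : k' = k
  · subst hk'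
    have hU : d.U = 1 := d.mem
    rw [rTerm_mk_self, hU]
    rw [Finset.sum_eq_zero fun X _ => by split_ifs <;> simp, abs_zero]
  · rw [rTerm_mk_of_ne θ p 𝒯 _ hk', abs_zero]

/-- **★ A6 — THE KEYED THEOREM 2 OF RECORD IS CONSISTENT**: on any family of keyed carriers of the UNIT CLASS, `B14.Thm2Printed` holds with `E₁ = R₁ = 0`, for every witness
family, `H033`, `L`, `β`, `κ₀` (contrast step 1: on the unkeyed carrier it is FALSE).  So §3's consumers are not vacuous by contradiction; §2's E-side ∕ R-side data remain
DISPLAYED hypotheses (A2). [cite: Balaban1988Convergent, Thm 2 p.263 (bookkeeping)] -/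
theorem thm2Printed_keyed_unitClass {ι : Type} (θ : ι → Stage13HParams F N) (p : ι → B12.RunParams)
    (𝒯 : (i : ι) → (k : ℕ) → SeqOfRecord F (θ i).ν (θ i).τ9.M (gOfRecord₁₃ F N (θ i).toStage13Params (p i)) (p i).K k →
      Sect2.TermValues (F.P (p i).K) (MatA N) (FluctV N) (θ i).τ9.M)
    (H033 : Flow → ℕ → Prop) (L β : ℝ) (κ₀ : ℕ) :
    B14.Thm2Printed H033 (fun i => sect2DataOfRecord₁₃Keyed (θ i) (p i) (𝒯 i) (fun _ _ => {1})) L β κ₀ :=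
  fun _ => ⟨0, 0, fun i _ _ => ⟨ineq243_keyed_unitClass (θ i) (p i) (𝒯 i) L β, ineq244_keyed_unitClass (θ i) (p i) (𝒯 i) κ₀⟩⟩

end A6

end Summit.QuantumFields.YangMills.Theorems.BalabanUVNodesN11Thm2OfRecordKeyed

end
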